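import Mathlib
import Summits.Ventures.PercRepro2.HalfLTwoMarkBlocks
import Summits.Ventures.PercRepro2.HalfLA1OMassesB
import Summits.Ventures.PercRepro2.HalfLA1ONonneg

/-!
# The blocks of `HalfLA1OPoly` are nonnegative on the ten cells of a probability vector
(blind cell PercRepro2, night-1 g37) — as `HalfLTwoMarkBlocks` / `HalfLA2BBlocks`.
-/

namespace Summit.Ventures.PercRepro2

namespace HalfLA1O

open CaseOne HalfLTwoMark HalfLA2B

section Blocks

variable {V : Type*} {E : Type*} [Fintype E] [DecidableEq E] [Fintype V] [DecidableEq V]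
  {R : Type*} [Field R] [LinearOrder R] [IsStrictOrderedRing R]

omit [Fintype V] [DecidableEq V] in
/-- The cells of a probability vector are nonnegative. -/
theorem cellsNonneg (p : E → R) (hp : IsProbVec p) (ends : E → Sym2 V) (o a₁ a₂ b : V) (eo eb : E) :
    (cellsA1O p ends o a₁ a₂ b eo eb).Nonneg := by
  have hp00 : IsProbVec (Function.update (Function.update p eo 0) eb 0) :=
    (hp.update eo le_rfl zero_le_one).update eb le_rfl zero_le_one
  unfold Cells10.Nonneg cellsA1O cells10Of
  dsimp only
  exact ⟨prob_nonneg hp00 _, prob_nonneg hp00 _, prob_nonneg hp00 _, prob_nonneg hp00 _,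
    prob_nonneg hp00 _, prob_nonneg hp00 _, prob_nonneg hp00 _, prob_nonneg hp00 _, prob_nonneg hp00 _,
    prob_nonneg hp00 _⟩

/-- **The blocks are nonnegative** on the cells of the base law of a probability vector. -/
theorem blocksNonneg (p : E → R) (hp : IsProbVec p) (ends : E → Sym2 V) (o a₁ a₂ b : V) (eo eb : E) :
    BlocksNonneg (cellsA1O p ends o a₁ a₂ b eo eb) := by
  set p00 := Function.update (Function.update p eo 0) eb 0 with hp00
  have hp0 : IsProbVec p00 := (hp.update eo le_rfl zero_le_one).update eb le_rfl zero_le_one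
  have tot := total_cells p00 ends o b a₁ a₂
  have nn := split_NN p00 ends o a₁ a₂ b
  rw [nn] at tot
  have oL := split_b p00 ends b a₁ a₂ (connEvent ends a₁ o)
  have oH := split_b p00 ends b a₁ a₂ (connEvent ends a₂ o)
  have bL := split_o p00 ends o a₁ a₂ (connEvent ends a₁ b)
  have bH := split_o p00 ends o a₁ a₂ (connEvent ends a₂ b)
  have eHL : prob p00 ((connEvent ends a₁ a₂)ᶜ ∩ connEvent ends a₁ b ∩ connEvent ends a₂ o) =
      prob p00 ((connEvent ends a₁ a₂)ᶜ ∩ connEvent ends a₂ o ∩ connEvent ends a₁ b) :=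
    prob_congr_set p00 (Set.inter_right_comm _ _ _)
  have hLL := bhk_same_cluster_events p00 hp0 ends a₁ a₂ (isUpperSet_mem_setOf b) (isUpperSet_mem_setOf o)
  rw [← connEvent_eq_clusterInEvent, ← connEvent_eq_clusterInEvent] at hLL
  have e1 : connEvent ends a₁ b ∩ (connEvent ends a₁ a₂)ᶜ =
      (connEvent ends a₁ a₂)ᶜ ∩ connEvent ends a₁ b := Set.inter_comm _ _
  have e2 : connEvent ends a₁ o ∩ (connEvent ends a₁ a₂)ᶜ =
      (connEvent ends a₁ a₂)ᶜ ∩ connEvent ends a₁ o := Set.inter_comm _ _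
  have e3 : connEvent ends a₁ b ∩ connEvent ends a₁ o ∩ (connEvent ends a₁ a₂)ᶜ =
      (connEvent ends a₁ a₂)ᶜ ∩ connEvent ends a₁ o ∩ connEvent ends a₁ b := by
    ext ω
    simp only [Set.mem_inter_iff, Set.mem_compl_iff]
    tauto
  rw [prob_congr_set p00 e1, prob_congr_set p00 e2, prob_congr_set p00 e3] at hLL
  have hHH := tm_bhk_same_a2 p00 hp0 ends o a₁ a₂ b
  have hHHN := tm_bhk_cross_b1_o2 p00 hp0 ends o a₁ a₂ b
  rw [eHL] at hHHN
  have hM2 := bhk_avoid_M1 p00 hp0 ends o a₂ a₁ b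
  rw [connEvent_comm ends a₂ a₁] at hM2
  have hM1o := tm_bhk_avoid_c1 p00 hp0 ends o a₁ a₂ b
  rw [eHL] at hM1o
  unfold BlocksNonneg blkLL blkHH blkHHN blkM2 blkM1o cellsA1O cells10Of
  dsimp only
  rw [← hp00]
  rw [tot] at hLL hHH hHHN hM2 hM1o
  rw [oL] at hLL hM1o
  rw [oH] at hHH hHHN hM2 hM1o
  rw [bL] at hLL hHHN hM2 hM1o
  rw [bH] at hHH hM2
  refine ⟨?_, ?_, ?_, ?_, ?_⟩
  · linear_combination hLL
  · linear_combination hHH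
  · linear_combination hHHN
  · linear_combination hM2
  · linear_combination hM1o

end Blocks

end HalfLA1O

end Summit.Ventures.PercRepro2
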